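import Mathlib
import HarnessLib
import Summits.HubbardSuperconductivity.HubbardSuperconductivity.Theorems.KLProgrammeAbsUmklappTargetCountPrescribedBound

/-!
# Route `KLProgramme` — K3 engine (stmt-HubbardSuperconductivity-20437), stub (b) (ℓ)/(I2)–(I3), located item «ABS-UMK-COUNT» / «ABS-UMK-34-SIGNPAT»:
# the bound of `card_targetStrings34_le` is `≤ c^L · (n′ + 1) · 2^{n′(L−|E|−2)}` — pure arithmetic, one logarithm

Cell gate-hubbard-kl, seat p4 g16 (≥ 3-free-leg twin of `targetBound_prescribed_le_pow`, p625142).  With `t = 2^{n′}` the narrow term of `card_targetStrings34_le`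
is `(M_g·2·L³)·(T_def + T_indef)·K₁^{L−F−3}` with `T_def ≤ E₁L²t`, `T_indef ≤ E₂L²(L+1)(n′+1)t` (the logarithm `log(A₁t + A₂L + 1) ≤ A₁ + A₂ + L + n′`), `K₁ ≤ 2(2Φ₀+1)t`,
`M_g ≤ 2π/Φ₀ + 1`; the wide term is the one of the anchored count.  Hence the closed bound is `≤ c^L·(n′+1)·2^{n′(L−F−2)}` with an explicit `c`:

* `one_add_log_le` — `1 + log(A₁t + A₂L + 1) ≤ (A₁ + A₂ + 1)(L + 1)(n′ + 1)` for `t = 2^{n′}`, `L ≥ 1`;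
* **`targetBound34_le_pow`**.

Everything is PROVED; no definitions, no named facts; arithmetic only. [folklore]
-/

noncomputable section

open Real Set
open Literature.MathematicalPhysics.QuantumLattice

namespace Summit.HubbardSuperconductivity.HubbardSuperconductivity.Theorems.AbsUmklappCount

set_option linter.dupNamespace false -- summit = problem name (single-conjunct summit), D-0017

/-- **The logarithm of the indefinite brick is affine in `L` and `n′`**: for `A₁, A₂ ≥ 0`, `L ≥ 1`, `t = 2^{n′}`,
`1 + log(A₁t + A₂L + 1) ≤ (A₁ + A₂ + 1)·(L + 1)·(n′ + 1)`. [folklore] -/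
theorem one_add_log_le {A₁ A₂ : ℝ} (hA₁ : 0 ≤ A₁) (hA₂ : 0 ≤ A₂) {L : ℕ} (hL : 1 ≤ L) (n' : ℕ) :
    1 + Real.log (A₁ * (2 : ℝ) ^ n' + A₂ * L + 1) ≤ (A₁ + A₂ + 1) * ((L : ℝ) + 1) * ((n' : ℝ) + 1) := by
  set t : ℝ := (2 : ℝ) ^ n' with ht
  have ht1 : 1 ≤ t := one_le_pow₀ (by norm_num)
  have hL1 : (1 : ℝ) ≤ L := by exact_mod_cast hL
  have hn0 : (0 : ℝ) ≤ n' := Nat.cast_nonneg _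
  -- `arg ≤ (A₁ + A₂ + 1)·L·t`
  have harg : A₁ * t + A₂ * L + 1 ≤ (A₁ + A₂ + 1) * L * t := by
    have hLt : (1 : ℝ) ≤ L * t := by nlinarith only [hL1, ht1]
    have h1 : A₁ * t ≤ A₁ * L * t := by
      have : A₁ * t * 1 ≤ A₁ * t * L := mul_le_mul_of_nonneg_left hL1 (by positivity)
      linarith only [this]
    have h2 : A₂ * L ≤ A₂ * L * t := by
      have : A₂ * L * 1 ≤ A₂ * L * t := mul_le_mul_of_nonneg_left ht1 (by positivity)
      linarith only [this]
    have h3 : (1 : ℝ) ≤ 1 * L * t := by linarith only [hLt]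
    have e : (A₁ + A₂ + 1) * L * t = A₁ * L * t + A₂ * L * t + 1 * L * t := by ring
    rw [e]; linarith only [h1, h2, h3]
  have hpos : 0 < A₁ * t + A₂ * L + 1 := by positivity
  have hlog1 : Real.log (A₁ * t + A₂ * L + 1) ≤ Real.log ((A₁ + A₂ + 1) * L * t) := Real.log_le_log hpos harg
  have hlog2 : Real.log ((A₁ + A₂ + 1) * L * t) = Real.log (A₁ + A₂ + 1) + Real.log L + Real.log t := by
    rw [Real.log_mul (by positivity) (by positivity), Real.log_mul (by positivity) (by positivity)]
  have hl1 : Real.log (A₁ + A₂ + 1) ≤ A₁ + A₂ := by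
    have := Real.log_le_sub_one_of_pos (by positivity : 0 < A₁ + A₂ + 1); linarith
  have hl2 : Real.log (L : ℝ) ≤ L - 1 := Real.log_le_sub_one_of_pos (by positivity)
  have hl3 : Real.log t ≤ n' := by
    rw [ht, Real.log_pow]
    have h2 : Real.log 2 ≤ 1 := by
      have := Real.log_two_lt_d9; linarith only [this]
    have := mul_le_mul_of_nonneg_left h2 hn0
    linarith only [this]
  have h4 : 1 + Real.log (A₁ * t + A₂ * L + 1) ≤ A₁ + A₂ + L + n' := by linarith only [hlog1, hlog2, hl1, hl2, hl3]
  have h5 : A₁ + A₂ + L + n' ≤ (A₁ + A₂ + 1) * ((L : ℝ) + 1) * ((n' : ℝ) + 1) := by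
    have hA : 0 ≤ A₁ + A₂ := by positivity
    have hL0 : (0 : ℝ) ≤ L := by positivity
    have h6 : 0 ≤ (L : ℝ) * n' := mul_nonneg hL0 hn0
    have h7 : (A₁ + A₂) * 1 ≤ (A₁ + A₂) * ((L : ℝ) * n' + L + n' + 1) :=
      mul_le_mul_of_nonneg_left (by linarith only [h6, hL1, hn0]) hA
    have e : (A₁ + A₂ + 1) * ((L : ℝ) + 1) * ((n' : ℝ) + 1) =
        (A₁ + A₂) * ((L : ℝ) * n' + L + n' + 1) + ((L : ℝ) * n' + L + n' + 1) := by ring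
    rw [e]; linarith only [h6, h7]
  linarith only [h4, h5]

set_option maxHeartbeats 800000 in -- one long chain of explicit inequalities on a large closed term (as `targetBound_prescribed_le_pow`)
/-- **The bound of `card_targetStrings34_le` in Lemma-3.1 shape (one logarithm).**  For `F + 3 ≤ L` (`F` = the number of prescribed legs), positive constants and
`B_fib ≤ a₆L²`, the closed bound is `≤ c^L · (n′ + 1) · 2^{n′(L−F−2)}` with
`c = (4(2π/Φ₀ + 1)(E₁ + E₂) + 1)·128(2Φ₀ + 1) + 384(a₆ + 1)`, `E₁` as in `targetBound_le_pow`,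
`E₂ = (16c₃/(s₁π) + 1)·(4(8M₁Φ₀/(s₁π) + 1) + 64c₃(1+B_f)/(c_f s₁²π²)·(16M₁Φ₀/(s₁π) + 8c₃/(s₁π) + 1))`. [folklore] -/
theorem targetBound34_le_pow {L n' F : ℕ} (hL : F + 3 ≤ L) {c₃ s₁ cf Af Bf M₁ Φ₀ Bfib a₆ : ℝ} (hc₃ : 0 < c₃) (hs₁ : 0 < s₁)
    (hcf : 0 < cf) (hAf : 0 < Af) (hBf : 0 ≤ Bf) (hM₁ : 0 ≤ M₁) (hΦ₀ : 0 < Φ₀) (ha₆ : 0 ≤ a₆) (hBfib : Bfib ≤ a₆ * (L : ℝ) ^ 2) :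
    (((⌊2 * π / Φ₀⌋₊ + 1 : ℕ) : ℝ) * 2 * (L : ℝ) ^ 3) *
      ((2 * (L * (4 * c₃ * (2 : ℝ) ^ (-(n' : ℤ)))) / (s₁ / 2 * sectorWidth n') + 1) *
          (960 * Af * (2 * (L * (4 * c₃ * (2 : ℝ) ^ (-(n' : ℤ))) + Bf * (L * (4 * c₃ * (2 : ℝ) ^ (-(n' : ℤ))))) +
            (4 * Bf + 1) * (s₁ / 2 * sectorWidth n')) / cf ^ 2 / (s₁ / 2 * sectorWidth n') ^ 2) +
        (2 * (L * (4 * c₃ * (2 : ℝ) ^ (-(n' : ℤ)))) / (s₁ / 2 * sectorWidth n') + 1) *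
          (4 * (2 * (M₁ * (2 * Φ₀)) / (s₁ / 2 * sectorWidth n') + 1) +
            4 * (L * (4 * c₃ * (2 : ℝ) ^ (-(n' : ℤ))) + Bf * (L * (4 * c₃ * (2 : ℝ) ^ (-(n' : ℤ))))) / (cf * (s₁ / 2 * sectorWidth n') ^ 2) *
              (1 + Real.log ((4 * (M₁ * (2 * Φ₀)) + L * (4 * c₃ * (2 : ℝ) ^ (-(n' : ℤ)))) / (s₁ / 2 * sectorWidth n') + 1)))) *
      (2 * (2 * (2 * Φ₀) / sectorWidth n' + 1)) ^ (L - (F + 3)) +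
      (L : ℝ) ^ 2 * 2 ^ L * (L ^ 2 * (Bfib * (3 * (2 : ℝ) ^ n') ^ (L - F - 2))) ≤
      ((4 * (2 * π / Φ₀ + 1) * (((16 * c₃ / (s₁ * π) + 1) * (3840 * Af * (8 * c₃ * (1 + Bf) + (4 * Bf + 1) * s₁ * π / 2) / (cf ^ 2 * s₁ ^ 2 * π ^ 2))) +
          ((16 * c₃ / (s₁ * π) + 1) * (4 * (8 * M₁ * Φ₀ / (s₁ * π) + 1) +
            64 * c₃ * (1 + Bf) / (cf * s₁ ^ 2 * π ^ 2) * (16 * M₁ * Φ₀ / (s₁ * π) + 8 * c₃ / (s₁ * π) + 1)))) + 1) * (128 * (2 * Φ₀ + 1)) +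
        384 * (a₆ + 1)) ^ L * ((n' : ℝ) + 1) * (2 : ℝ) ^ (n' * (L - F - 2)) := by
  have hπ := Real.pi_pos
  have hπ3 := Real.pi_gt_three
  set t : ℝ := (2 : ℝ) ^ n' with ht
  have ht1 : 1 ≤ t := one_le_pow₀ (by norm_num)
  have ht0 : 0 < t := by positivity
  have hLnat : 1 ≤ L := by omega
  have hL1 : (1 : ℝ) ≤ L := by exact_mod_cast hLnat
  have hL0 : (0 : ℝ) < L := by linarith
  have hn1 : (1 : ℝ) ≤ (n' : ℝ) + 1 := by have : (0:ℝ) ≤ n' := Nat.cast_nonneg _; linarith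
  set E₁ : ℝ := (16 * c₃ / (s₁ * π) + 1) * (3840 * Af * (8 * c₃ * (1 + Bf) + (4 * Bf + 1) * s₁ * π / 2) / (cf ^ 2 * s₁ ^ 2 * π ^ 2)) with hE₁
  have hE₁0 : 0 ≤ E₁ := by rw [hE₁]; positivity
  set α : ℝ := 16 * c₃ / (s₁ * π) with hα
  set β : ℝ := 8 * M₁ * Φ₀ / (s₁ * π) with hβ
  set γ : ℝ := 64 * c₃ * (1 + Bf) / (cf * s₁ ^ 2 * π ^ 2) with hγ
  set A₁ : ℝ := 16 * M₁ * Φ₀ / (s₁ * π) with hA₁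
  set A₂ : ℝ := 8 * c₃ / (s₁ * π) with hA₂
  have hα0 : 0 ≤ α := by rw [hα]; positivity
  have hβ0 : 0 ≤ β := by rw [hβ]; positivity
  have hγ0 : 0 ≤ γ := by rw [hγ]; positivity
  have hA₁0 : 0 ≤ A₁ := by rw [hA₁]; positivity
  have hA₂0 : 0 ≤ A₂ := by rw [hA₂]; positivity
  set E₂ : ℝ := (α + 1) * (4 * (β + 1) + γ * (A₁ + A₂ + 1)) with hE₂
  have hE₂0 : 0 ≤ E₂ := by rw [hE₂]; positivity
  -- closed forms
  have hw : sectorWidth n' = π / t := sectorWidth_eq_pi_div_pow n'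
  have hz : (2 : ℝ) ^ (-(n' : ℤ)) = t⁻¹ := two_zpow_neg_eq_inv_pow n'
  rw [hw, hz]
  have e1 : 2 * (L * (4 * c₃ * t⁻¹)) / (s₁ / 2 * (π / t)) = α * L := by rw [hα]; field_simp; ring
  have e2 : 960 * Af * (2 * (L * (4 * c₃ * t⁻¹) + Bf * (L * (4 * c₃ * t⁻¹))) + (4 * Bf + 1) * (s₁ / 2 * (π / t))) / cf ^ 2 /
      (s₁ / 2 * (π / t)) ^ 2 = 3840 * Af * (8 * L * c₃ * (1 + Bf) + (4 * Bf + 1) * s₁ * π / 2) / (cf ^ 2 * s₁ ^ 2 * π ^ 2) * t := by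
    field_simp
    ring
  have e3 : 2 * (2 * (2 * Φ₀) / (π / t) + 1) = 2 * (4 * Φ₀ * t / π + 1) := by field_simp; ring
  have e4 : 4 * (2 * (M₁ * (2 * Φ₀)) / (s₁ / 2 * (π / t)) + 1) = 4 * (β * t + 1) := by rw [hβ]; field_simp; ring
  have e5 : 4 * (L * (4 * c₃ * t⁻¹) + Bf * (L * (4 * c₃ * t⁻¹))) / (cf * (s₁ / 2 * (π / t)) ^ 2) = γ * L * t := by
    rw [hγ]; field_simp; ring
  have e6 : (4 * (M₁ * (2 * Φ₀)) + L * (4 * c₃ * t⁻¹)) / (s₁ / 2 * (π / t)) + 1 = A₁ * t + A₂ * L + 1 := by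
    rw [hA₁, hA₂]; field_simp; ring
  rw [e1, e2, e3, e4, e5, e6]
  clear e1 e2 e3 e4 e5 e6 hw hz
  -- the pieces
  have hαL : α * L + 1 ≤ (α + 1) * L := by nlinarith only [hα0, hL1]
  have hEL : 3840 * Af * (8 * L * c₃ * (1 + Bf) + (4 * Bf + 1) * s₁ * π / 2) / (cf ^ 2 * s₁ ^ 2 * π ^ 2) * t ≤
      (3840 * Af * (8 * c₃ * (1 + Bf) + (4 * Bf + 1) * s₁ * π / 2) / (cf ^ 2 * s₁ ^ 2 * π ^ 2)) * L * t := by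
    rw [← mul_div_right_comm (3840 * Af * (8 * c₃ * (1 + Bf) + (4 * Bf + 1) * s₁ * π / 2))]
    refine mul_le_mul_of_nonneg_right ?_ ht0.le
    rw [div_le_div_iff_of_pos_right (by positivity)]
    have h3 : 8 * L * c₃ * (1 + Bf) + (4 * Bf + 1) * s₁ * π / 2 ≤ (8 * c₃ * (1 + Bf) + (4 * Bf + 1) * s₁ * π / 2) * L := by
      have h0 : 0 ≤ (4 * Bf + 1) * s₁ * π / 2 := by positivity
      have h4 : (4 * Bf + 1) * s₁ * π / 2 * 1 ≤ (4 * Bf + 1) * s₁ * π / 2 * L := mul_le_mul_of_nonneg_left hL1 h0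
      have e : (8 * c₃ * (1 + Bf) + (4 * Bf + 1) * s₁ * π / 2) * L = 8 * L * c₃ * (1 + Bf) + (4 * Bf + 1) * s₁ * π / 2 * L := by ring
      rw [e]; linarith only [h4]
    have h5 := mul_le_mul_of_nonneg_left h3 (by positivity : (0 : ℝ) ≤ 3840 * Af)
    have e : 3840 * Af * (8 * c₃ * (1 + Bf) + (4 * Bf + 1) * s₁ * π / 2) * ↑L = 3840 * Af * ((8 * c₃ * (1 + Bf) + (4 * Bf + 1) * s₁ * π / 2) * ↑L) := by
      ring
    rw [e]; exact h5
  -- `T_def ≤ E₁ L² t`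
  have hTdef : (α * L + 1) * (3840 * Af * (8 * L * c₃ * (1 + Bf) + (4 * Bf + 1) * s₁ * π / 2) / (cf ^ 2 * s₁ ^ 2 * π ^ 2) * t) ≤
      E₁ * (L : ℝ) ^ 2 * t := by
    have h0 : 0 ≤ 3840 * Af * (8 * L * c₃ * (1 + Bf) + (4 * Bf + 1) * s₁ * π / 2) / (cf ^ 2 * s₁ ^ 2 * π ^ 2) * t := by positivity
    calc (α * L + 1) * (3840 * Af * (8 * L * c₃ * (1 + Bf) + (4 * Bf + 1) * s₁ * π / 2) / (cf ^ 2 * s₁ ^ 2 * π ^ 2) * t)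
        ≤ ((α + 1) * L) * ((3840 * Af * (8 * c₃ * (1 + Bf) + (4 * Bf + 1) * s₁ * π / 2) / (cf ^ 2 * s₁ ^ 2 * π ^ 2)) * L * t) :=
          mul_le_mul hαL hEL h0 (by positivity)
      _ = E₁ * (L : ℝ) ^ 2 * t := by rw [hE₁, hα]; ring
  -- `T_indef ≤ E₂ L²(L+1)(n′+1) t`
  have hlog := one_add_log_le hA₁0 hA₂0 hLnat n'
  rw [← ht] at hlog
  have hlog0 : 0 ≤ 1 + Real.log (A₁ * t + A₂ * L + 1) := by
    have : 0 ≤ Real.log (A₁ * t + A₂ * L + 1) := Real.log_nonneg (by nlinarith [mul_nonneg hA₁0 ht0.le, mul_nonneg hA₂0 hL0.le])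
    linarith
  have hP : 1 ≤ ((L : ℝ) + 1) * ((n' : ℝ) + 1) := by nlinarith only [hL1, hn1]
  have hLP : 1 ≤ L * (((L : ℝ) + 1) * ((n' : ℝ) + 1)) := by nlinarith only [hL1, hP]
  have hinner : 4 * (β * t + 1) + γ * L * t * (1 + Real.log (A₁ * t + A₂ * L + 1)) ≤
      (4 * (β + 1) + γ * (A₁ + A₂ + 1)) * (L * ((L : ℝ) + 1) * ((n' : ℝ) + 1)) * t := by
    have h1 : 4 * (β * t + 1) ≤ 4 * (β + 1) * (L * ((L : ℝ) + 1) * ((n' : ℝ) + 1)) * t := by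
      have h2 : β * t + 1 ≤ (β + 1) * t := by nlinarith only [hβ0, ht1]
      have h4 : 0 ≤ (β + 1) * t := by positivity
      have h3 : (β + 1) * t * 1 ≤ (β + 1) * t * (L * (((L : ℝ) + 1) * ((n' : ℝ) + 1))) := mul_le_mul_of_nonneg_left hLP h4
      have e : 4 * (β + 1) * (L * ((L : ℝ) + 1) * ((n' : ℝ) + 1)) * t = 4 * ((β + 1) * t * (L * (((L : ℝ) + 1) * ((n' : ℝ) + 1)))) := by ring
      rw [e]; linarith only [h2, h3]
    have h2 : γ * L * t * (1 + Real.log (A₁ * t + A₂ * L + 1)) ≤ γ * (A₁ + A₂ + 1) * (L * ((L : ℝ) + 1) * ((n' : ℝ) + 1)) * t := by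
      have := mul_le_mul_of_nonneg_left hlog (by positivity : 0 ≤ γ * L * t)
      have e : γ * (A₁ + A₂ + 1) * (L * ((L : ℝ) + 1) * ((n' : ℝ) + 1)) * t = γ * L * t * ((A₁ + A₂ + 1) * ((L : ℝ) + 1) * ((n' : ℝ) + 1)) := by
        ring
      rw [e]; exact this
    have e : (4 * (β + 1) + γ * (A₁ + A₂ + 1)) * (L * ((L : ℝ) + 1) * ((n' : ℝ) + 1)) * t =
        4 * (β + 1) * (L * ((L : ℝ) + 1) * ((n' : ℝ) + 1)) * t + γ * (A₁ + A₂ + 1) * (L * ((L : ℝ) + 1) * ((n' : ℝ) + 1)) * t := by ring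
    rw [e]; exact add_le_add h1 h2
  have hTind : (α * L + 1) * (4 * (β * t + 1) + γ * L * t * (1 + Real.log (A₁ * t + A₂ * L + 1))) ≤
      E₂ * ((L : ℝ) ^ 2 * ((L : ℝ) + 1) * ((n' : ℝ) + 1)) * t := by
    have h0 : 0 ≤ 4 * (β * t + 1) + γ * L * t * (1 + Real.log (A₁ * t + A₂ * L + 1)) := by positivity
    calc (α * L + 1) * (4 * (β * t + 1) + γ * L * t * (1 + Real.log (A₁ * t + A₂ * L + 1)))
        ≤ ((α + 1) * L) * ((4 * (β + 1) + γ * (A₁ + A₂ + 1)) * (L * ((L : ℝ) + 1) * ((n' : ℝ) + 1)) * t) :=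
          mul_le_mul hαL hinner h0 (by positivity)
      _ = E₂ * ((L : ℝ) ^ 2 * ((L : ℝ) + 1) * ((n' : ℝ) + 1)) * t := by rw [hE₂]; ring
  have hTsum : (α * L + 1) * (3840 * Af * (8 * L * c₃ * (1 + Bf) + (4 * Bf + 1) * s₁ * π / 2) / (cf ^ 2 * s₁ ^ 2 * π ^ 2) * t) +
      (α * L + 1) * (4 * (β * t + 1) + γ * L * t * (1 + Real.log (A₁ * t + A₂ * L + 1))) ≤
      (E₁ + E₂) * ((L : ℝ) ^ 2 * ((L : ℝ) + 1) * ((n' : ℝ) + 1)) * t := by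
    have h1 : E₁ * (L : ℝ) ^ 2 * t ≤ E₁ * ((L : ℝ) ^ 2 * ((L : ℝ) + 1) * ((n' : ℝ) + 1)) * t := by
      have : (L : ℝ) ^ 2 ≤ (L : ℝ) ^ 2 * ((L : ℝ) + 1) * ((n' : ℝ) + 1) := by
        have : (L : ℝ) ^ 2 * 1 ≤ (L : ℝ) ^ 2 * (((L : ℝ) + 1) * ((n' : ℝ) + 1)) := mul_le_mul_of_nonneg_left hP (by positivity)
        have e : (L : ℝ) ^ 2 * ((L : ℝ) + 1) * ((n' : ℝ) + 1) = (L : ℝ) ^ 2 * (((L : ℝ) + 1) * ((n' : ℝ) + 1)) := by ring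
        rw [e]; linarith only [this]
      have h2 := mul_le_mul_of_nonneg_left this hE₁0
      exact mul_le_mul_of_nonneg_right h2 ht0.le
    have e : (E₁ + E₂) * ((L : ℝ) ^ 2 * ((L : ℝ) + 1) * ((n' : ℝ) + 1)) * t =
        E₁ * ((L : ℝ) ^ 2 * ((L : ℝ) + 1) * ((n' : ℝ) + 1)) * t + E₂ * ((L : ℝ) ^ 2 * ((L : ℝ) + 1) * ((n' : ℝ) + 1)) * t := by ring
    rw [e]; exact add_le_add (hTdef.trans h1) hTind
  -- the grid count and the cone count
  have hMg : (((⌊2 * π / Φ₀⌋₊ + 1 : ℕ) : ℝ)) ≤ 2 * π / Φ₀ + 1 := by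
    have h := Nat.floor_le (show 0 ≤ 2 * π / Φ₀ by positivity)
    push_cast
    linarith only [h]
  set K : ℝ := 2 * (4 * Φ₀ * t / π + 1) with hK
  have hK0 : 0 ≤ K := by rw [hK]; positivity
  have hKle : K ≤ 2 * (2 * Φ₀ + 1) * t := by
    have h1 : 4 * Φ₀ * t / π ≤ 2 * Φ₀ * t := by
      rw [div_le_iff₀ hπ]
      have h0 : 0 ≤ Φ₀ * t := by positivity
      have := mul_le_mul_of_nonneg_left (show (2 : ℝ) ≤ π by linarith only [hπ3]) h0
      linarith only [this]
    rw [hK]; linarith only [h1, ht1]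
  have hKpow : K ^ (L - (F + 3)) ≤ (2 * (2 * Φ₀ + 1)) ^ L * t ^ (L - (F + 3)) := by
    calc K ^ (L - (F + 3)) ≤ (2 * (2 * Φ₀ + 1) * t) ^ (L - (F + 3)) := pow_le_pow_left₀ hK0 hKle _
      _ = (2 * (2 * Φ₀ + 1)) ^ (L - (F + 3)) * t ^ (L - (F + 3)) := mul_pow _ _ _
      _ ≤ (2 * (2 * Φ₀ + 1)) ^ L * t ^ (L - (F + 3)) :=
          mul_le_mul_of_nonneg_right (pow_le_pow_right₀ (by linarith) (by omega)) (by positivity)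
  -- powers of `t` and of `L`
  have htpow : t * t ^ (L - (F + 3)) = t ^ (L - F - 2) := by
    rw [← pow_succ']; congr 1; omega
  have ht3 : t ^ (L - F - 2) = (2 : ℝ) ^ (n' * (L - F - 2)) := by rw [ht, ← pow_mul]
  have hL6 := natCast_pow_six_le L
  have hL56 : (L : ℝ) ^ 3 * ((L : ℝ) ^ 2 * ((L : ℝ) + 1)) ≤ 2 * (64 : ℝ) ^ L := by
    have : (L : ℝ) ^ 3 * ((L : ℝ) ^ 2 * ((L : ℝ) + 1)) = (L : ℝ) ^ 6 + (L : ℝ) ^ 5 := by ring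
    have h5 : (L : ℝ) ^ 5 ≤ (L : ℝ) ^ 6 := by
      calc (L : ℝ) ^ 5 = (L : ℝ) ^ 5 * 1 := by ring
        _ ≤ (L : ℝ) ^ 5 * L := mul_le_mul_of_nonneg_left hL1 (by positivity)
        _ = (L : ℝ) ^ 6 := by ring
    rw [this]; linarith only [h5, hL6]
  -- the narrow term
  set Cn : ℝ := 4 * (2 * π / Φ₀ + 1) * (E₁ + E₂) with hCn
  have hCn0 : 0 ≤ Cn := by rw [hCn]; positivity
  have hnarrow : (((⌊2 * π / Φ₀⌋₊ + 1 : ℕ) : ℝ) * 2 * (L : ℝ) ^ 3) *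
      ((α * L + 1) * (3840 * Af * (8 * L * c₃ * (1 + Bf) + (4 * Bf + 1) * s₁ * π / 2) / (cf ^ 2 * s₁ ^ 2 * π ^ 2) * t) +
        (α * L + 1) * (4 * (β * t + 1) + γ * L * t * (1 + Real.log (A₁ * t + A₂ * L + 1)))) * K ^ (L - (F + 3)) ≤
      (Cn + 1) ^ L * (128 * (2 * Φ₀ + 1)) ^ L * ((n' : ℝ) + 1) * t ^ (L - F - 2) := by
    have hT0 : 0 ≤ (α * L + 1) * (3840 * Af * (8 * L * c₃ * (1 + Bf) + (4 * Bf + 1) * s₁ * π / 2) / (cf ^ 2 * s₁ ^ 2 * π ^ 2) * t) +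
        (α * L + 1) * (4 * (β * t + 1) + γ * L * t * (1 + Real.log (A₁ * t + A₂ * L + 1))) := by positivity
    calc (((⌊2 * π / Φ₀⌋₊ + 1 : ℕ) : ℝ) * 2 * (L : ℝ) ^ 3) *
          ((α * L + 1) * (3840 * Af * (8 * L * c₃ * (1 + Bf) + (4 * Bf + 1) * s₁ * π / 2) / (cf ^ 2 * s₁ ^ 2 * π ^ 2) * t) +
            (α * L + 1) * (4 * (β * t + 1) + γ * L * t * (1 + Real.log (A₁ * t + A₂ * L + 1)))) * K ^ (L - (F + 3))
        ≤ ((2 * π / Φ₀ + 1) * 2 * (L : ℝ) ^ 3) * ((E₁ + E₂) * ((L : ℝ) ^ 2 * ((L : ℝ) + 1) * ((n' : ℝ) + 1)) * t) *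
            ((2 * (2 * Φ₀ + 1)) ^ L * t ^ (L - (F + 3))) := by
          refine mul_le_mul (mul_le_mul ?_ hTsum hT0 (by positivity)) hKpow (by positivity) (by positivity)
          exact mul_le_mul_of_nonneg_right (mul_le_mul_of_nonneg_right hMg (by norm_num)) (by positivity)
      _ = 2 * (2 * π / Φ₀ + 1) * (E₁ + E₂) * ((L : ℝ) ^ 3 * ((L : ℝ) ^ 2 * ((L : ℝ) + 1))) * ((n' : ℝ) + 1) *
            (2 * (2 * Φ₀ + 1)) ^ L * (t * t ^ (L - (F + 3))) := by ring
      _ ≤ 2 * (2 * π / Φ₀ + 1) * (E₁ + E₂) * (2 * (64 : ℝ) ^ L) * ((n' : ℝ) + 1) * (2 * (2 * Φ₀ + 1)) ^ L * (t * t ^ (L - (F + 3))) := by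
          have h0 : 0 ≤ 2 * (2 * π / Φ₀ + 1) * (E₁ + E₂) := by positivity
          have h1 := mul_le_mul_of_nonneg_left hL56 h0
          have h2 : 0 ≤ ((n' : ℝ) + 1) * (2 * (2 * Φ₀ + 1)) ^ L * (t * t ^ (L - (F + 3))) := by positivity
          have h3 := mul_le_mul_of_nonneg_right h1 h2
          have e1 : 2 * (2 * π / Φ₀ + 1) * (E₁ + E₂) * ((L : ℝ) ^ 3 * ((L : ℝ) ^ 2 * ((L : ℝ) + 1))) * ((n' : ℝ) + 1) *
              (2 * (2 * Φ₀ + 1)) ^ L * (t * t ^ (L - (F + 3))) =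
              2 * (2 * π / Φ₀ + 1) * (E₁ + E₂) * ((L : ℝ) ^ 3 * ((L : ℝ) ^ 2 * ((L : ℝ) + 1))) *
                (((n' : ℝ) + 1) * (2 * (2 * Φ₀ + 1)) ^ L * (t * t ^ (L - (F + 3)))) := by ring
          have e2 : 2 * (2 * π / Φ₀ + 1) * (E₁ + E₂) * (2 * (64 : ℝ) ^ L) * ((n' : ℝ) + 1) * (2 * (2 * Φ₀ + 1)) ^ L * (t * t ^ (L - (F + 3))) =
              2 * (2 * π / Φ₀ + 1) * (E₁ + E₂) * (2 * (64 : ℝ) ^ L) *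
                (((n' : ℝ) + 1) * (2 * (2 * Φ₀ + 1)) ^ L * (t * t ^ (L - (F + 3)))) := by ring
          rw [e1, e2]; exact h3
      _ = Cn * ((64 : ℝ) ^ L * (2 * (2 * Φ₀ + 1)) ^ L) * ((n' : ℝ) + 1) * t ^ (L - F - 2) := by rw [htpow, hCn]; ring
      _ ≤ (Cn + 1) ^ L * ((64 : ℝ) ^ L * (2 * (2 * Φ₀ + 1)) ^ L) * ((n' : ℝ) + 1) * t ^ (L - F - 2) := by
          have := le_add_one_pow hCn0 hLnat
          gcongr
      _ = (Cn + 1) ^ L * (128 * (2 * Φ₀ + 1)) ^ L * ((n' : ℝ) + 1) * t ^ (L - F - 2) := by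
          have h : (64 : ℝ) ^ L * (2 * (2 * Φ₀ + 1)) ^ L = (128 * (2 * Φ₀ + 1)) ^ L := by rw [← mul_pow]; congr 1; ring
          rw [h]
  -- the wide term
  have h3pow : (3 : ℝ) ^ (L - F - 2) ≤ (3 : ℝ) ^ L := pow_le_pow_right₀ (by norm_num) (by omega)
  have hwide : (L : ℝ) ^ 2 * 2 ^ L * (L ^ 2 * (Bfib * (3 * t) ^ (L - F - 2))) ≤ (384 * (a₆ + 1)) ^ L * ((n' : ℝ) + 1) * t ^ (L - F - 2) := by
    calc (L : ℝ) ^ 2 * 2 ^ L * (L ^ 2 * (Bfib * (3 * t) ^ (L - F - 2)))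
        = (L : ℝ) ^ 4 * Bfib * (2 ^ L * 3 ^ (L - F - 2)) * t ^ (L - F - 2) := by rw [mul_pow]; ring
      _ ≤ (L : ℝ) ^ 4 * (a₆ * (L : ℝ) ^ 2) * (2 ^ L * 3 ^ L) * t ^ (L - F - 2) := by
          have h1 : (L : ℝ) ^ 4 * Bfib ≤ (L : ℝ) ^ 4 * (a₆ * (L : ℝ) ^ 2) := mul_le_mul_of_nonneg_left hBfib (by positivity)
          have h2 : (2 : ℝ) ^ L * 3 ^ (L - F - 2) ≤ 2 ^ L * 3 ^ L := mul_le_mul_of_nonneg_left h3pow (by positivity)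
          exact mul_le_mul_of_nonneg_right (mul_le_mul h1 h2 (by positivity) (by positivity)) (by positivity)
      _ = a₆ * (L : ℝ) ^ 6 * (6 : ℝ) ^ L * t ^ (L - F - 2) := by
          have h6 : (2 : ℝ) ^ L * 3 ^ L = 6 ^ L := by rw [← mul_pow]; norm_num
          rw [h6]; ring
      _ ≤ a₆ * (64 : ℝ) ^ L * (6 : ℝ) ^ L * t ^ (L - F - 2) := by
          have h1 : a₆ * (L : ℝ) ^ 6 ≤ a₆ * (64 : ℝ) ^ L := mul_le_mul_of_nonneg_left hL6 ha₆
          exact mul_le_mul_of_nonneg_right (mul_le_mul_of_nonneg_right h1 (by positivity)) (by positivity)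
      _ ≤ (a₆ + 1) ^ L * ((64 : ℝ) ^ L * (6 : ℝ) ^ L) * t ^ (L - F - 2) := by
          rw [show a₆ * (64 : ℝ) ^ L * (6 : ℝ) ^ L = a₆ * ((64 : ℝ) ^ L * (6 : ℝ) ^ L) by ring]
          exact mul_le_mul_of_nonneg_right (mul_le_mul_of_nonneg_right (le_add_one_pow ha₆ hLnat) (by positivity)) (by positivity)
      _ = (384 * (a₆ + 1)) ^ L * 1 * t ^ (L - F - 2) := by
          rw [← mul_pow, ← mul_pow, mul_one]; congr 2; ring
      _ ≤ (384 * (a₆ + 1)) ^ L * ((n' : ℝ) + 1) * t ^ (L - F - 2) := by gcongr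
  -- sum
  have hsum : (Cn + 1) ^ L * (128 * (2 * Φ₀ + 1)) ^ L * ((n' : ℝ) + 1) * t ^ (L - F - 2) + (384 * (a₆ + 1)) ^ L * ((n' : ℝ) + 1) * t ^ (L - F - 2) ≤
      ((Cn + 1) * (128 * (2 * Φ₀ + 1)) + 384 * (a₆ + 1)) ^ L * ((n' : ℝ) + 1) * t ^ (L - F - 2) := by
    rw [← mul_pow, ← add_mul, ← add_mul]
    refine mul_le_mul_of_nonneg_right (mul_le_mul_of_nonneg_right (pow_add_pow_le (by positivity) (by positivity) (by omega)) (by positivity))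
      (by positivity)
  rw [← ht3]
  refine le_trans (add_le_add hnarrow hwide) (le_trans hsum (le_of_eq ?_))
  rw [hCn, hE₁, hE₂, hα, hβ, hγ, hA₁, hA₂]

end Summit.HubbardSuperconductivity.HubbardSuperconductivity.Theorems.AbsUmklappCount

end
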